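import Literature.Analysis.FluidPDE.MVRelativeEnergyPointwise
import HarnessLib

/-!
# The pointwise relative-energy inequality (Březina–Feireisl 2018, §3.2.2 Steps 2–3): bounds

Continuation of `MVRelativeEnergyPointwise.lean`. We bound the reduced right-hand side
`reducedRHS` (BF (3.9)) by a multiple of the relative energy `relEnergyFull`:

* `reducedRHS_eq_remainders` / `reducedRHS_le_essential` — for states in the `δ`-box of the
  reference state (BF's "essential" part): the first-order terms cancel EXACTLY thanks to
  Maxwell's relation and the temperature equation of the strong solution, and the quadratic
  remainders are absorbed by the local coercivity of `R` (BF Step 2, Step 3);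
* `reducedRHS_le_residual` — off the box ("residual" part): every term is `≲ 1 + ρ + ρ|s| + ρe +
  ρ|v|²`, which the residual coercivity and the growth bounds control (BF (3.8), hypothesis (3.1)).

The analytic input (each term's bound) is separated from the final arithmetic
(`essential_combine`, `residual_combine`), so that every proof has a small context; the
elementary inequalities and `StrongPointData.Bounded` live in `MVRelativeEnergyPointwise.lean`.
The uniform statement (constants from compactness) is assembled in `MVRelativeEnergyMaster.lean`.

## References

* J. Březina, E. Feireisl, J. Math. Soc. Japan 70 (2018), §3.2.2, (3.8)–(3.11).
-/

noncomputable section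

open Set Filter Function Metric Finset
open scoped Topology BigOperators

namespace Literature.Analysis.FluidPDE

namespace CompressibleEuler

open StrongPointData

/-! ## The entropy cut-off `Z_{a,b}` -/

/-- BF's cut-off `Z_{a,b}(s) = a ∨ (s ∧ b)` (clamp to `[a,b]`).
[cite: BrezinaFeireisl2018, §3.2] -/
def clamp (a b x : ℝ) : ℝ := max a (min x b)

/-- On `[a,b]` the clamp is the identity. [folklore] -/
theorem clamp_eq_self {a b x : ℝ} (ha : a ≤ x) (hb : x ≤ b) : clamp a b x = x := by
  simp [clamp, ha, hb]

/-- The clamp is bounded by `max |a| |b|` (for `a ≤ b`). [folklore] -/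
theorem abs_clamp_le {a b : ℝ} (hab : a ≤ b) (x : ℝ) : |clamp a b x| ≤ max |a| |b| := by
  unfold clamp
  rcases le_total x b with h | h
  · rw [min_eq_left h]
    rcases le_total a x with h' | h'
    · rw [max_eq_right h']
      exact abs_le_max_abs_abs h' h
    · rw [max_eq_left h']; exact le_max_left _ _
  · rw [min_eq_right h, max_eq_right hab]; exact le_max_right _ _

/-- Above `a`, clamping only decreases: `clamp a b x ≤ x` for `a ≤ x`. [folklore] -/
theorem clamp_le_self {a b x : ℝ} (ha : a ≤ x) : clamp a b x ≤ x := by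
  unfold clamp
  exact max_le ha (min_le_left _ _)

/-- The clamp is continuous. [folklore] -/
theorem continuous_clamp (a b : ℝ) : Continuous (clamp a b) := by
  unfold clamp; fun_prop

/-- The clamp is monotone. [folklore] -/
theorem monotone_clamp (a b : ℝ) : Monotone (clamp a b) := fun x y h => by
  unfold clamp
  exact max_le_max le_rfl (min_le_min_right b h)

/-- The clamp is an admissible entropy cut-off (`DissipativeMVEuler.IsEntropyCutoff`).
[cite: BrezinaFeireisl2018, Def. 2.9] -/
theorem isEntropyCutoff_clamp {a b : ℝ} (hab : a ≤ b) : IsEntropyCutoff (clamp a b) :=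
  ⟨continuous_clamp a b, monotone_clamp a b, ⟨max |a| |b|, abs_clamp_le hab⟩⟩

variable {eos : EulerEOS}

/-- The kinetic part of the relative energy as `ρ/2 ∑ vᵢ²`, `v = m/ρ - U`. [folklore] -/
theorem kinetic_eq (d : StrongPointData) {ρ : ℝ} (hρ : ρ ≠ 0) (m : EuclideanSpace ℝ (Fin 3)) :
    (∑ i, (m i - ρ * d.U i) ^ 2) / (2 * ρ) = ρ / 2 * ∑ i, (m i / ρ - d.U i) ^ 2 := by
  have key : ∀ i, (m i - ρ * d.U i) ^ 2 = ρ ^ 2 * (m i / ρ - d.U i) ^ 2 := fun i => by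
    rw [← mul_pow]; congr 1; field_simp
  simp only [key, ← mul_sum]
  field_simp

/-! ## Term-by-term bounds -/

/-- The convective term: `|ρ ∑ᵢⱼ vᵢvⱼ ∂ⱼUᵢ| ≤ 3M ρ ∑vᵢ²`. [cite: BrezinaFeireisl2018, §3.2.2 Step 1] -/
theorem bound_quad {v : Fin 3 → ℝ} {g : Fin 3 → Fin 3 → ℝ} {M ρ : ℝ} (hg : ∀ i j, |g i j| ≤ M)
    (hM : 0 ≤ M) (hρ : 0 ≤ ρ) :
    |ρ * ∑ i, ∑ j, v i * v j * g i j| ≤ 3 * M * (ρ * ∑ i, v i ^ 2) := by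
  rw [abs_mul, abs_of_nonneg hρ]
  have h1 := abs_sum_sum_mul_le (s := univ) (v := v) hg
  have h2 := sq_sum_abs_le_three v
  calc ρ * |∑ i, ∑ j, v i * v j * g i j| ≤ ρ * (M * (∑ i, |v i|) ^ 2) :=
        mul_le_mul_of_nonneg_left h1 hρ
    _ ≤ ρ * (M * (3 * ∑ i, v i ^ 2)) :=
        mul_le_mul_of_nonneg_left (mul_le_mul_of_nonneg_left h2 hM) hρ
    _ = 3 * M * (ρ * ∑ i, v i ^ 2) := by ring

/-- A product bound `|a b| ≤ A B`. [folklore] -/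
theorem abs_mul_le_of_le {a b A B : ℝ} (ha : |a| ≤ A) (hb : |b| ≤ B) : |a * b| ≤ A * B := by
  rw [abs_mul]; exact mul_le_mul ha hb (abs_nonneg _) ((abs_nonneg _).trans ha)

/-- The mixed first/second order term of the essential part:
`|x (a x + b y) t| ≤ 2 S D (x² + y²)` for `|a|,|b| ≤ S`, `|t| ≤ D`. [folklore] -/
theorem bound_mixed {x y a b t S D : ℝ} (ha : |a| ≤ S) (hb : |b| ≤ S) (ht : |t| ≤ D) :
    |x * (a * x + b * y) * t| ≤ 2 * S * D * (x ^ 2 + y ^ 2) := by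
  have hS : 0 ≤ S := (abs_nonneg _).trans ha
  have hD : 0 ≤ D := (abs_nonneg _).trans ht
  have h1 : |x * (a * x + b * y)| ≤ 2 * S * (x ^ 2 + y ^ 2) := by
    rw [abs_mul]
    have h2 : |a * x + b * y| ≤ S * |x| + S * |y| := by
      refine (abs_add_le _ _).trans (add_le_add ?_ ?_)
      · rw [abs_mul]; exact mul_le_mul_of_nonneg_right ha (abs_nonneg _)
      · rw [abs_mul]; exact mul_le_mul_of_nonneg_right hb (abs_nonneg _)
    have e1 : |x| * |x| = x ^ 2 := by rw [← sq, sq_abs]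
    have e2 := two_mul_abs_mul_abs_le x y
    have e3 : |x| * (S * |x| + S * |y|) = S * (|x| * |x|) + S * (|x| * |y|) := by ring
    have e4 : S * (|x| * |y|) ≤ S * (x ^ 2 + y ^ 2) :=
      mul_le_mul_of_nonneg_left (by nlinarith [sq_nonneg y]) hS
    have e5 : S * x ^ 2 ≤ S * (x ^ 2 + y ^ 2) :=
      mul_le_mul_of_nonneg_left (by nlinarith [sq_nonneg y]) hS
    calc |x| * |a * x + b * y| ≤ |x| * (S * |x| + S * |y|) :=
          mul_le_mul_of_nonneg_left h2 (abs_nonneg _)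
      _ = S * x ^ 2 + S * (|x| * |y|) := by rw [e3, e1]
      _ ≤ 2 * S * (x ^ 2 + y ^ 2) := by linarith
  calc |x * (a * x + b * y) * t| ≤ 2 * S * (x ^ 2 + y ^ 2) * D := abs_mul_le_of_le h1 ht
    _ = 2 * S * D * (x ^ 2 + y ^ 2) := by ring

/-- The entropy-transport term of the essential part:
`|ρ σ ∑ vᵢ gᵢ| ≤ L M P (x² + y²) + (3/2) L M ρ ∑vᵢ²` for `|σ| ≤ L(|x| + |y|)`, `|gᵢ| ≤ M`,
`0 ≤ ρ ≤ P`. [folklore] -/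
theorem bound_transport_ess {v g : Fin 3 → ℝ} {ρ σ L M P x y : ℝ} (hg : ∀ i, |g i| ≤ M)
    (hM : 0 ≤ M) (hL : 0 ≤ L) (hρ : 0 ≤ ρ) (hρP : ρ ≤ P) (hσ : |σ| ≤ L * (|x| + |y|)) :
    |ρ * σ * ∑ i, v i * g i| ≤ L * M * P * (x ^ 2 + y ^ 2) + 3 / 2 * L * M * (ρ * ∑ i, v i ^ 2) := by
  have h1 : |∑ i, v i * g i| ≤ M * ∑ i, |v i| := by
    have : ∑ i, v i * g i = ∑ i, g i * v i := sum_congr rfl fun i _ => mul_comm _ _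
    rw [this]
    exact abs_sum_mul_le univ fun i _ => hg i
  have h2 : (|x| + |y|) * ∑ i, |v i| ≤ (x ^ 2 + y ^ 2) + 3 / 2 * ∑ i, v i ^ 2 := by
    have e1 := sq_abs_add_abs_le x y
    have e2 := sq_sum_abs_le_three v
    have e3 := mul_le_half_sq_add_sq (|x| + |y|) (∑ i, |v i|)
    linarith
  have hq : 0 ≤ x ^ 2 + y ^ 2 := by positivity
  rw [abs_mul, abs_mul, abs_of_nonneg hρ]
  calc ρ * |σ| * |∑ i, v i * g i| ≤ ρ * (L * (|x| + |y|)) * (M * ∑ i, |v i|) :=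
        mul_le_mul (mul_le_mul_of_nonneg_left hσ hρ) h1 (abs_nonneg _) (by positivity)
    _ = L * M * ρ * ((|x| + |y|) * ∑ i, |v i|) := by ring
    _ ≤ L * M * ρ * ((x ^ 2 + y ^ 2) + 3 / 2 * ∑ i, v i ^ 2) :=
        mul_le_mul_of_nonneg_left h2 (by positivity)
    _ = L * M * (ρ * (x ^ 2 + y ^ 2)) + 3 / 2 * L * M * (ρ * ∑ i, v i ^ 2) := by ring
    _ ≤ L * M * (P * (x ^ 2 + y ^ 2)) + 3 / 2 * L * M * (ρ * ∑ i, v i ^ 2) := by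
        have := mul_le_mul_of_nonneg_left (mul_le_mul_of_nonneg_right hρP hq)
          (by positivity : 0 ≤ L * M)
        linarith
    _ = L * M * P * (x ^ 2 + y ^ 2) + 3 / 2 * L * M * (ρ * ∑ i, v i ^ 2) := by ring

/-- The entropy-transport term of the residual part:
`|ρ σ ∑ vᵢ gᵢ| ≤ (3/2) Σ M ρ + (Σ M/2) ρ∑vᵢ²` for `|σ| ≤ Σ`, `|gᵢ| ≤ M`. [folklore] -/
theorem bound_transport_res {v g : Fin 3 → ℝ} {ρ σ Sg M : ℝ} (hg : ∀ i, |g i| ≤ M)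
    (hM : 0 ≤ M) (hρ : 0 ≤ ρ) (hσ : |σ| ≤ Sg) :
    |ρ * σ * ∑ i, v i * g i| ≤ 3 / 2 * Sg * M * ρ + Sg * M / 2 * (ρ * ∑ i, v i ^ 2) := by
  have h1 : |∑ i, v i * g i| ≤ M * ∑ i, |v i| := by
    have : ∑ i, v i * g i = ∑ i, g i * v i := sum_congr rfl fun i _ => mul_comm _ _
    rw [this]
    exact abs_sum_mul_le univ fun i _ => hg i
  have h2 := sum_abs_le_three v
  have hSg : 0 ≤ Sg := (abs_nonneg _).trans hσ
  rw [abs_mul, abs_mul, abs_of_nonneg hρ]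
  calc ρ * |σ| * |∑ i, v i * g i| ≤ ρ * Sg * (M * ((3 + ∑ i, v i ^ 2) / 2)) :=
        mul_le_mul (mul_le_mul_of_nonneg_left hσ hρ)
          (h1.trans (mul_le_mul_of_nonneg_left h2 hM)) (abs_nonneg _) (by positivity)
    _ = 3 / 2 * Sg * M * ρ + Sg * M / 2 * (ρ * ∑ i, v i ^ 2) := by ring

/-! ## The final arithmetic -/

/-- Arithmetic of the essential part. [folklore] -/
theorem essential_combine {t1 t2 t3 t4 t5 M L S P D c q K R : ℝ}
    (hM : 0 ≤ M) (hL : 0 ≤ L) (hS : 0 ≤ S) (hP : 0 ≤ P) (hD : 0 ≤ D) (hc : 0 < c)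
    (hK : 0 ≤ K) (hq : 0 ≤ q) (hcoer : c * q ≤ R)
    (h1 : |t1| ≤ 3 * M * K) (h2 : |t2| ≤ 3 * M * L * q) (h3 : |t3| ≤ 2 * S * D * q)
    (h4 : |t4| ≤ P * L * D * q) (h5 : |t5| ≤ L * M * P * q + 3 / 2 * L * M * K) :
    -t1 - t2 - t3 - t4 - t5 ≤
      (6 * M + 3 * L * M + (3 * M * L + 2 * S * D + P * L * D + L * M * P) / c) * (K / 2 + R) := by
  have hR : 0 ≤ R := le_trans (by positivity) hcoer
  have hB : 0 ≤ 3 * M * L + 2 * S * D + P * L * D + L * M * P := by positivity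
  have hBq : (3 * M * L + 2 * S * D + P * L * D + L * M * P) * q ≤
      (3 * M * L + 2 * S * D + P * L * D + L * M * P) / c * R := by
    calc (3 * M * L + 2 * S * D + P * L * D + L * M * P) * q
        = (3 * M * L + 2 * S * D + P * L * D + L * M * P) / c * (c * q) := by field_simp
      _ ≤ (3 * M * L + 2 * S * D + P * L * D + L * M * P) / c * R :=
          mul_le_mul_of_nonneg_left hcoer (by positivity)
  have e : (6 * M + 3 * L * M + (3 * M * L + 2 * S * D + P * L * D + L * M * P) / c) *
      (K / 2 + R) =
      (6 * M + 3 * L * M) * (K / 2) + (3 * M * L + 2 * S * D + P * L * D + L * M * P) / c * R +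
        ((6 * M + 3 * L * M) * R +
          (3 * M * L + 2 * S * D + P * L * D + L * M * P) / c * (K / 2)) := by ring
  have hx : 0 ≤ (6 * M + 3 * L * M) * R +
      (3 * M * L + 2 * S * D + P * L * D + L * M * P) / c * (K / 2) := by positivity
  rw [e]
  linarith [neg_le_abs t1, neg_le_abs t2, neg_le_abs t3, neg_le_abs t4, neg_le_abs t5]

/-- Arithmetic of the residual part. [folklore] -/
theorem residual_combine {t1 t2 t3 t4 t5 M Sg B₂ B₃ B₄ ρ G K R E : ℝ}
    (hM : 0 ≤ M) (hSg : 0 ≤ Sg) (hB₂ : 0 ≤ B₂) (hB₃ : 0 ≤ B₃) (hB₄ : 0 ≤ B₄) (hE : 0 ≤ E)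
    (hK : 0 ≤ K) (hR : 0 ≤ R) (hρG : ρ ≤ G) (hGR : G ≤ E * R)
    (h1 : |t1| ≤ 3 * M * K) (h2 : |t2| ≤ B₂ * G) (h3 : |t3| ≤ B₃ * G) (h4 : |t4| ≤ B₄ * G)
    (h5 : |t5| ≤ 3 / 2 * Sg * M * ρ + Sg * M / 2 * K) :
    -t1 + t2 - t3 + t4 + t5 ≤
      (2 * (3 * M + Sg * M / 2) + (B₂ + B₃ + B₄ + 3 / 2 * Sg * M) * E) * (K / 2 + R) := by
  have hB : 0 ≤ B₂ + B₃ + B₄ + 3 / 2 * Sg * M := by positivity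
  have hBG : (B₂ + B₃ + B₄ + 3 / 2 * Sg * M) * G ≤ (B₂ + B₃ + B₄ + 3 / 2 * Sg * M) * E * R := by
    have := mul_le_mul_of_nonneg_left hGR hB; linarith
  have hρ' : 3 / 2 * Sg * M * ρ ≤ 3 / 2 * Sg * M * G :=
    mul_le_mul_of_nonneg_left hρG (by positivity)
  have e : (2 * (3 * M + Sg * M / 2) + (B₂ + B₃ + B₄ + 3 / 2 * Sg * M) * E) * (K / 2 + R) =
      (3 * M + Sg * M / 2) * K + (B₂ + B₃ + B₄ + 3 / 2 * Sg * M) * E * R +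
        (2 * (3 * M + Sg * M / 2) * R + (B₂ + B₃ + B₄ + 3 / 2 * Sg * M) * E * (K / 2)) := by
    ring
  have hx : 0 ≤ 2 * (3 * M + Sg * M / 2) * R +
      (B₂ + B₃ + B₄ + 3 / 2 * Sg * M) * E * (K / 2) := by positivity
  rw [e]
  linarith [neg_le_abs t1, le_abs_self t2, neg_le_abs t3, le_abs_self t4, le_abs_self t5]

/-! ## The essential bound (BF Steps 2–3 near the reference state) -/

/-- **Steps 2–3, exact cancellation.** Under the continuity equation `Dₜr = -r divU`, Maxwell's
relation `p_ϑ/r + r s_ρ = 0`, the temperature equation `p_ϑ divU + r s_ϑ DₜΘ = 0` and an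
inactive cut-off, the reduced right-hand side equals a sum of five SECOND-ORDER remainders.
[cite: BrezinaFeireisl2018, §3.2.2 Steps 2–3] -/
theorem reducedRHS_eq_remainders {Z : ℝ → ℝ} {d : StrongPointData} {ρ E : ℝ}
    {m : EuclideanSpace ℝ (Fin 3)} (hr : d.r ≠ 0) (hmass : d.MassEq)
    (hZ : Z (eos.s ρ (stateTemp eos ρ E)) = eos.s ρ (stateTemp eos ρ E))
    (hMax : d.pϑ eos / d.r + d.r * deriv (fun x => eos.s x d.Θ) d.r = 0)
    (hTemp : d.pϑ eos * d.divU + d.r * deriv (fun θ => eos.s d.r θ) d.Θ * d.DtΘ = 0) :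
    reducedRHS eos Z d ρ E m =
      -(ρ * ∑ i, ∑ j, (m i / ρ - d.U i) * (m j / ρ - d.U j) * d.gU i j) -
        (eos.p ρ (stateTemp eos ρ E) - eos.p d.r d.Θ - d.pρ eos * (ρ - d.r) -
          d.pϑ eos * (stateTemp eos ρ E - d.Θ)) * d.divU -
        (ρ - d.r) * (deriv (fun x => eos.s x d.Θ) d.r * (ρ - d.r) +
          deriv (fun θ => eos.s d.r θ) d.Θ * (stateTemp eos ρ E - d.Θ)) * d.DtΘ -
        ρ * (eos.s ρ (stateTemp eos ρ E) - eos.s d.r d.Θ -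
          deriv (fun x => eos.s x d.Θ) d.r * (ρ - d.r) -
          deriv (fun θ => eos.s d.r θ) d.Θ * (stateTemp eos ρ E - d.Θ)) * d.DtΘ -
        ρ * (eos.s ρ (stateTemp eos ρ E) - eos.s d.r d.Θ) * ∑ i, (m i / ρ - d.U i) * d.gΘ i := by
  have hDtr : d.Dtr = -(d.r * d.divU) := by
    have := hmass; unfold MassEq at this; linarith
  have e1 : d.pϑ eos = -(d.r ^ 2 * deriv (fun x => eos.s x d.Θ) d.r) := by
    field_simp at hMax
    linarith
  have hinv : d.r * d.r⁻¹ = 1 := mul_inv_cancel₀ hr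
  unfold reducedRHS
  rw [hZ, pt_add_sum, hDtr]
  simp only [Fin.sum_univ_three]
  -- the velocity defects `vᵢ = mᵢ/ρ - Uᵢ` enter both sides verbatim: treat them as atoms
  generalize m 0 / ρ - d.U 0 = v₀
  generalize m 1 / ρ - d.U 1 = v₁
  generalize m 2 / ρ - d.U 2 = v₂
  rw [e1] at hTemp ⊢
  rw [div_eq_mul_inv]
  linear_combination (-(stateTemp eos ρ E - d.Θ)) * hTemp +
    ((ρ - d.r) * (d.divU * d.pρ eos + d.r * deriv (fun x => eos.s x d.Θ) d.r * d.DtΘ)) * hinv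

/-- **Essential part.** At a state in the `δ`-box of `(r,Θ)` (cut-off inactive), given the
linearisation remainders of `p` and `s`, Maxwell's relation, the temperature equation, the
continuity equation, bounds `M` on the data, `ρ ≤ P`, `|s_ρ|, |s_ϑ| ≤ S` and local coercivity
`c((ρ-r)² + (ϑ-Θ)²) ≤ R`, the reduced right-hand side is at most an explicit multiple of the
relative energy. [cite: BrezinaFeireisl2018, §3.2.2 Steps 2–3, (3.11)] -/
theorem reducedRHS_le_essential {Z : ℝ → ℝ} {d : StrongPointData} {M L S P c ρ E : ℝ}
    {m : EuclideanSpace ℝ (Fin 3)}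
    (hM : 0 ≤ M) (hL : 0 ≤ L) (hS : 0 ≤ S) (hc : 0 < c) (hB : d.Bounded M) (hr : 0 < d.r)
    (hρ : 0 < ρ) (hρP : ρ ≤ P) (hmass : d.MassEq)
    (hZ : Z (eos.s ρ (stateTemp eos ρ E)) = eos.s ρ (stateTemp eos ρ E))
    (hMax : d.pϑ eos / d.r + d.r * deriv (fun x => eos.s x d.Θ) d.r = 0)
    (hTemp : d.pϑ eos * d.divU + d.r * deriv (fun θ => eos.s d.r θ) d.Θ * d.DtΘ = 0)
    (hsρ : |deriv (fun x => eos.s x d.Θ) d.r| ≤ S) (hsϑ : |deriv (fun θ => eos.s d.r θ) d.Θ| ≤ S)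
    (hp_lin : |eos.p ρ (stateTemp eos ρ E) - eos.p d.r d.Θ - d.pρ eos * (ρ - d.r) -
        d.pϑ eos * (stateTemp eos ρ E - d.Θ)| ≤
        L * ((ρ - d.r) ^ 2 + (stateTemp eos ρ E - d.Θ) ^ 2))
    (hs_lin : |eos.s ρ (stateTemp eos ρ E) - eos.s d.r d.Θ -
        deriv (fun x => eos.s x d.Θ) d.r * (ρ - d.r) -
        deriv (fun θ => eos.s d.r θ) d.Θ * (stateTemp eos ρ E - d.Θ)| ≤
        L * ((ρ - d.r) ^ 2 + (stateTemp eos ρ E - d.Θ) ^ 2))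
    (hs_lip : |eos.s ρ (stateTemp eos ρ E) - eos.s d.r d.Θ| ≤
        L * (|ρ - d.r| + |stateTemp eos ρ E - d.Θ|))
    (hcoer : c * ((ρ - d.r) ^ 2 + (stateTemp eos ρ E - d.Θ) ^ 2) ≤
        eos.relEnergyThermo d.r d.Θ ρ (stateTemp eos ρ E)) :
    reducedRHS eos Z d ρ E m ≤
      (6 * M + 3 * L * M + (3 * M * L + 2 * S * (M + 3 * M * M) + P * L * (M + 3 * M * M) +
        L * M * P) / c) * relEnergyFull eos d ρ E m := by
  have hρ' : ρ ≠ 0 := hρ.ne'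
  have hP0 : 0 ≤ P := hρ.le.trans hρP
  have hD0 : 0 ≤ M + 3 * M * M := by positivity
  have hdiv := hB.abs_divU_le
  have hDt := hB.abs_DtΘ_le
  have hkin : relEnergyFull eos d ρ E m =
      ρ * (∑ i, (m i / ρ - d.U i) ^ 2) / 2 +
        eos.relEnergyThermo d.r d.Θ ρ (stateTemp eos ρ E) := by
    unfold relEnergyFull; rw [kinetic_eq d hρ' m]; ring
  rw [reducedRHS_eq_remainders hr.ne' hmass hZ hMax hTemp, hkin]
  refine essential_combine (D := M + 3 * M * M) hM hL hS hP0 hD0 hc (by positivity)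
    (by positivity) hcoer ?_ ?_ ?_ ?_ ?_
  · exact bound_quad hB.2.2.2.2.2.2 hM hρ.le
  · calc _ ≤ L * ((ρ - d.r) ^ 2 + (stateTemp eos ρ E - d.Θ) ^ 2) * (3 * M) :=
          abs_mul_le_of_le hp_lin hdiv
      _ = _ := by ring
  · exact bound_mixed hsρ hsϑ hDt
  · rw [mul_assoc]
    calc _ ≤ P * (L * ((ρ - d.r) ^ 2 + (stateTemp eos ρ E - d.Θ) ^ 2) * (M + 3 * M * M)) := by
          rw [abs_mul, abs_of_pos hρ]
          exact mul_le_mul hρP (abs_mul_le_of_le hs_lin hDt) (abs_nonneg _) hP0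
      _ = _ := by ring
  · exact bound_transport_ess hB.2.2.2.2.2.1 hM hL hρ.le hρP hs_lip

/-! ## The residual bound (BF (3.8), second part, and hypothesis (3.1)) -/

/-- **Residual part.** Off the `δ`-box every term of the reduced right-hand side is
`≲ 1 + ρ + ρ|s(ρ,E)| + E + ρ|v|²`, controlled by the residual coercivity `R ≥ c₀` and the growth
bounds `ρ ≤ C(1+R)`, `ρe, ρ|s| ≤ C(1+ρ+R)` through the pressure growth hypothesis (3.1).
[cite: BrezinaFeireisl2018, §3.2.2, (3.8), (3.1)] -/
theorem reducedRHS_le_residual {Z : ℝ → ℝ} {d : StrongPointData}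
    {M Pk Sk Zb cg c₀ Cg rmin ρ E : ℝ} {m : EuclideanSpace ℝ (Fin 3)}
    (hM : 0 ≤ M) (hPk0 : 0 ≤ Pk) (hSk0 : 0 ≤ Sk) (hZb0 : 0 ≤ Zb) (hcg : 0 ≤ cg) (hc₀ : 0 < c₀)
    (hCg : 0 ≤ Cg) (hrmin : 0 < rmin) (hr : rmin ≤ d.r) (hρ : 0 < ρ) (hB : d.Bounded M)
    (hPk : |eos.p d.r d.Θ| ≤ Pk) (hSk : |eos.s d.r d.Θ| ≤ Sk)
    (hpρ : |d.pρ eos| ≤ Sk) (hpϑ : |d.pϑ eos| ≤ Sk) (hZb : ∀ x, |Z x| ≤ Zb)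
    (hgrowth : |eos.p ρ (stateTemp eos ρ E)| ≤
      cg * (1 + ρ + ρ * |eos.s ρ (stateTemp eos ρ E)| + ρ * eos.e ρ (stateTemp eos ρ E)))
    (hR : c₀ ≤ eos.relEnergyThermo d.r d.Θ ρ (stateTemp eos ρ E))
    (hρC : ρ ≤ Cg * (1 + eos.relEnergyThermo d.r d.Θ ρ (stateTemp eos ρ E)))
    (heC : ρ * eos.e ρ (stateTemp eos ρ E) ≤
      Cg * (1 + ρ + eos.relEnergyThermo d.r d.Θ ρ (stateTemp eos ρ E)))
    (hsC : ρ * |eos.s ρ (stateTemp eos ρ E)| ≤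
      Cg * (1 + ρ + eos.relEnergyThermo d.r d.Θ ρ (stateTemp eos ρ E))) :
    reducedRHS eos Z d ρ E m ≤
      (2 * (3 * M + (Sk + Zb) * M / 2) +
        ((3 * M * Pk + 3 * M * cg + 6 * M * cg * Cg) + 2 * Sk * (M + 3 * M * M) * (1 / rmin + 1) +
          (Sk + Zb) * (M + 3 * M * M) + 3 / 2 * (Sk + Zb) * M) * ((1 + Cg) * (1 / c₀ + 1))) *
        relEnergyFull eos d ρ E m := by
  have hρ' : ρ ≠ 0 := hρ.ne'
  have hr0 : 0 < d.r := hrmin.trans_le hr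
  -- abbreviations through opaque variables
  obtain ⟨R, hRdef⟩ : ∃ R, R = eos.relEnergyThermo d.r d.Θ ρ (stateTemp eos ρ E) := ⟨_, rfl⟩
  obtain ⟨G, hGdef⟩ : ∃ G, G = 1 + ρ + R := ⟨_, rfl⟩
  rw [← hRdef] at hR hρC heC hsC
  have hR0 : 0 ≤ R := hc₀.le.trans hR
  have hG1 : 1 ≤ G := by rw [hGdef]; linarith
  have hG0 : 0 ≤ G := zero_le_one.trans hG1
  have hρG : ρ ≤ G := by rw [hGdef]; linarith
  have hD0 : 0 ≤ M + 3 * M * M := by positivity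
  have hdiv := hB.abs_divU_le
  have hDt := hB.abs_DtΘ_le
  have hDr := hB.abs_Dtr_le
  have hsZ : |eos.s d.r d.Θ - Z (eos.s ρ (stateTemp eos ρ E))| ≤ Sk + Zb :=
    (abs_sub _ _).trans (add_le_add hSk (hZb _))
  have hkin : relEnergyFull eos d ρ E m = ρ * (∑ i, (m i / ρ - d.U i) ^ 2) / 2 + R := by
    unfold relEnergyFull; rw [kinetic_eq d hρ' m, hRdef]; ring
  -- `G ≤ (1+Cg)(1/c₀+1) R`
  have hGR : G ≤ (1 + Cg) * (1 / c₀ + 1) * R := by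
    have h1 : G ≤ (1 + Cg) * (1 + R) := by
      have e : (1 + Cg) * (1 + R) = 1 + Cg * (1 + R) + R := by ring
      rw [e, hGdef]; linarith
    have h2 : 1 ≤ 1 / c₀ * R := by
      rw [one_div, ← div_eq_inv_mul, le_div_iff₀ hc₀]; linarith
    have e1 : (1 + Cg) * (1 / c₀ + 1) * R = (1 + Cg) * (1 / c₀ * R) + (1 + Cg) * R := by ring
    have e2 : (1 + Cg) * (1 + R) = (1 + Cg) * 1 + (1 + Cg) * R := by ring
    have h3 : (1 + Cg) * 1 ≤ (1 + Cg) * (1 / c₀ * R) := mul_le_mul_of_nonneg_left h2 (by positivity)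
    linarith
  unfold reducedRHS
  rw [hkin]
  refine residual_combine (B₂ := 3 * M * Pk + 3 * M * cg + 6 * M * cg * Cg)
    (B₃ := 2 * Sk * (M + 3 * M * M) * (1 / rmin + 1)) (B₄ := (Sk + Zb) * (M + 3 * M * M))
    hM (by positivity : 0 ≤ Sk + Zb) (by positivity) (by positivity) (by positivity)
    (by positivity) (by positivity) hR0 hρG hGR ?_ ?_ ?_ ?_ ?_
  · exact bound_quad hB.2.2.2.2.2.2 hM hρ.le
  · -- pressure term
    have h1 : |eos.p d.r d.Θ - eos.p ρ (stateTemp eos ρ E)| ≤ Pk + cg * (1 + ρ + 2 * Cg * G) := by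
      refine (abs_sub _ _).trans (add_le_add hPk (hgrowth.trans ?_))
      refine mul_le_mul_of_nonneg_left ?_ hcg
      rw [hGdef]; linarith
    have h2 : Pk + cg * (1 + ρ + 2 * Cg * G) ≤ (Pk + cg + 2 * cg * Cg) * G := by
      have e1 : Pk ≤ Pk * G := le_mul_of_one_le_right hPk0 hG1
      have e2 : cg * (1 + ρ) ≤ cg * G := mul_le_mul_of_nonneg_left (by rw [hGdef]; linarith) hcg
      have e3 : (Pk + cg + 2 * cg * Cg) * G = Pk * G + cg * G + cg * (2 * Cg * G) := by ring
      have e4 : cg * (1 + ρ + 2 * Cg * G) = cg * (1 + ρ) + cg * (2 * Cg * G) := by ring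
      rw [e3, e4]; linarith
    calc _ ≤ (Pk + cg + 2 * cg * Cg) * G * (3 * M) := abs_mul_le_of_le (h1.trans h2) hdiv
      _ = _ := by ring
  · -- material derivative of the pressure
    rw [pt_add_sum]
    have h1 : |(ρ - d.r) / d.r| ≤ ρ / rmin + 1 := by
      rw [abs_div, abs_of_pos hr0, div_le_iff₀ hr0]
      refine (abs_sub _ _).trans ?_
      rw [abs_of_pos hρ, abs_of_pos hr0, add_mul, one_mul]
      have : ρ ≤ ρ / rmin * d.r := by
        rw [div_mul_eq_mul_div, le_div_iff₀ hrmin]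
        exact mul_le_mul_of_nonneg_left hr hρ.le
      linarith
    have h2 : |d.pρ eos * d.Dtr + d.pϑ eos * d.DtΘ| ≤ 2 * Sk * (M + 3 * M * M) := by
      refine (abs_add_le _ _).trans ?_
      have e1 := abs_mul_le_of_le hpρ hDr
      have e2 := abs_mul_le_of_le hpϑ hDt
      linarith
    have h3 : ρ / rmin + 1 ≤ (1 / rmin + 1) * G := by
      have e1 : ρ / rmin ≤ 1 / rmin * G := by
        rw [one_div, ← div_eq_inv_mul]
        exact div_le_div_of_nonneg_right hρG hrmin.le
      have e2 : (1 / rmin + 1) * G = 1 / rmin * G + G := by ring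
      rw [e2]; linarith
    calc _ ≤ (1 / rmin + 1) * G * (2 * Sk * (M + 3 * M * M)) := abs_mul_le_of_le (h1.trans h3) h2
      _ = _ := by ring
  · -- entropy production against `DₜΘ`
    calc _ ≤ G * (Sk + Zb) * (M + 3 * M * M) := by
          rw [abs_mul, abs_mul, abs_of_pos hρ]
          exact mul_le_mul (mul_le_mul hρG hsZ (abs_nonneg _) hG0) hDt (abs_nonneg _)
            (by positivity)
      _ = _ := by ring
  · exact bound_transport_res hB.2.2.2.2.2.1 hM hρ.le hsZ

end CompressibleEuler

end Literature.Analysis.FluidPDE
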